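import Mathlib
import HarnessLib
import Literature.MathematicalPhysics.StatisticalMechanics.TorusFRDStepKernelPair
import Literature.MathematicalPhysics.StatisticalMechanics.FluctuationKernelComparisonTrace

/-!
# `StepKernelBounds` along the SEGMENT between two step kernels of one `TorusFRD` package
# (the `L^p` weight input of the dimension-free [ABKM19] Lemma 8.4, `ℓ = 1`)

`FluctuationKernelComparisonTrace.tayNormLE_fluct_sub_fluct_of_sum_sq` (the dimension-free Lemma 8.4)
needs `StepKernelBounds` for the dilated kernels `p·𝒞_t` along the kernel segment
`𝒞_t = 𝒞b + t(𝒞a − 𝒞b)`, `t ∈ [0,1]`.  The hypotheses of Lemma 7.7 in multiplier form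
(`AbkmWeightBounds.stepKernelBounds_const_mul`: even kernel, nonnegative multipliers dominated by
`(1+ρ'')ĉ_{k+1}/p`, the bound `L^{dk}|γ_q| ≤ C₂` for the quadratic shift) are CONVEX in the kernel, so
they hold along the segment as soon as they hold at the two ends:

* `gradCov_kernelSeg` — `γ(𝒞_t) = γ(𝒞b) + t(γ(𝒞a) − γ(𝒞b))`;
* **`AbkmWeightBounds.stepKernelBounds_const_mul_kernelSeg`** — the abstract convexity statement;
* **`stepKernelBounds_const_mul_kernelSeg_of_torusFRD`** — for the step kernels `𝒞_{1+q,k+1}`,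
  `𝒞_{1+q',k+1}` of one package, `q, q'` symmetric in the ball `Σ|q_{ij}| ≤ T₀` (`T₀ ≤ ½`,
  `K T₀ ≤ log(1+ρ)`), `p(1+ρ) ≤ 1+ρ''`, `ρ'' < θ̄`: `StepKernelBounds` for
  `p·(𝒞_{1+q,k+1} + t(𝒞_{1+q',k+1} − 𝒞_{1+q,k+1}))`, every `t ∈ [0,1]`, with (w7′)-constant `A𝒫(ρ'')`
  and `γ`-constant `p·secondDiffConst`.

Everything is proved; no named fact.

## References
* S. Adams, S. Buchholz, R. Kotecký, S. Müller, arXiv:1910.13564, Lemma 7.7 (7.75), Lemma 8.4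
  [AdamsBuchholzKoteckyMuller2019].
* S. Buchholz, J. Funct. Anal. 275 (2018), Thm 2.4, Thm 4.5 [Buchholz2016].
-/

noncomputable section

namespace Literature.MathematicalPhysics.StatisticalMechanics.GradientRG

open scoped BigOperators
open Real Set Finset MeasureTheory
open Literature.MathematicalPhysics.StatisticalMechanics.GradientFRD
  (fourierCoeff cExt cExt_of_mem IsElliptic IsUnitSymm InShell iterDiff supNorm conv ellOp isElliptic_one
    exists_inShell re_fourierCoeff_zero_of_sum_eq_zero)
open Literature.MathematicalPhysics.StatisticalMechanics.TorusPolymer (IsPolymer numBlocks)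
open Literature.MathematicalPhysics.QuantumFieldTheory

variable {d M : ℕ} [NeZero M]

omit [NeZero M] in
/-- The quadratic shift is affine along the kernel segment: `γ(𝒞b + t(𝒞a − 𝒞b)) = γ(𝒞b) + t(γ(𝒞a) − γ(𝒞b))`.
[cite: AdamsBuchholzKoteckyMuller2019, Theorem 6.8 (6.64)] -/
theorem gradCov_kernelSeg (𝒞a 𝒞b : (Fin d → ZMod M) → ℝ) (t : ℝ) (q : quadIndex d) :
    gradCov (fun x => 𝒞b x + t * (𝒞a x - 𝒞b x)) q = gradCov 𝒞b q + t * (gradCov 𝒞a q - gradCov 𝒞b q) := by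
  unfold gradCov; ring

/-- **Convexity of the hypotheses of Lemma 7.7 along the kernel segment**: if two even kernels `𝒞a, 𝒞b`
have nonnegative multipliers with `p · Re 𝒞̂ ≤ (1+ρ)ĉ_{k+1}` and `L^{dk}|γ| ≤ C₂`, then for every
`t ∈ [0,1]` the dilated segment kernel `p·(𝒞b + t(𝒞a − 𝒞b))` satisfies `StepKernelBounds` relative to
the `q = 0` weights with (w7′)-constant `A𝒫(ρ)` and `γ`-constant `p·C₂`.
[cite: AdamsBuchholzKoteckyMuller2019, Lemma 7.7] -/
theorem AbkmWeightBounds.stepKernelBounds_const_mul_kernelSeg {L N Mord R n : ℕ}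
    {θbar lam μ δ₁ δ₀ A𝒫 : ℝ} {𝒞 : ℕ → (Fin d → ZMod M) → ℝ}
    (hd : 2 ≤ d) (hMord : 1 ≤ Mord) (hMR : Mord ≤ R) (hLodd : Odd L) (hL : 2 ^ (d + 3) + 16 * R ≤ L)
    (hθbar : 0 < θbar) (hlam : 0 < lam)
    (hB : AbkmWeightBounds L N Mord R n θbar lam μ δ₁ δ₀ A𝒫 𝒞
      (abkmWeightData L N Mord R θbar (schedDelta δ₀ δ₁ N) 𝒞))
    (hn : 2 * Mord ≤ n) {Cα : (Fin d → ℕ) → ℝ}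
    (hCα : ∀ j, 1 ≤ j → j ≤ N + 1 → ∀ θ' : Fin d → ℕ, ∑ i, θ' i ≤ n →
      ∀ x, |GradientFRD.iterDiff θ' (𝒞 j) x| ≤ Cα θ' / (L : ℝ) ^ ((j - 1) * (d - 2 + ∑ i, θ' i)))
    {k : ℕ} (hk : k + 1 ≤ N + 1) {ρ : ℝ} (hρ0 : 0 ≤ ρ) (hρ : ρ < θbar)
    {𝒞a 𝒞b : (Fin d → ZMod M) → ℝ} (hea : ∀ x, 𝒞a (-x) = 𝒞a x) (heb : ∀ x, 𝒞b (-x) = 𝒞b x)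
    (ha_nonneg : ∀ κ, 0 ≤ (fourierCoeff 𝒞a κ).re) (hb_nonneg : ∀ κ, 0 ≤ (fourierCoeff 𝒞b κ).re)
    {p : ℝ} (hp : 0 ≤ p)
    (ha_le : ∀ κ, p * (fourierCoeff 𝒞a κ).re ≤ (1 + ρ) * cExt N (fun j => fourierCoeff (𝒞 j) κ) (k + 1))
    (hb_le : ∀ κ, p * (fourierCoeff 𝒞b κ).re ≤ (1 + ρ) * cExt N (fun j => fourierCoeff (𝒞 j) κ) (k + 1))
    {C₂ : ℝ} (hγa : ∀ q : quadIndex d, ((L ^ (d * k) : ℕ) : ℝ) * |gradCov 𝒞a q| ≤ C₂)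
    (hγb : ∀ q : quadIndex d, ((L ^ (d * k) : ℕ) : ℝ) * |gradCov 𝒞b q| ≤ C₂)
    {t : ℝ} (ht0 : 0 ≤ t) (ht1 : t ≤ 1) :
    StepKernelBounds (abkmWeightData L N Mord R θbar (schedDelta δ₀ δ₁ N) 𝒞) L k
      (weightIntConstRho θbar ρ (traceConst d Mord R lam (derivSum d n fun θ' _ => Cα θ'))) (p * C₂)
      (fun x => p * (𝒞b x + t * (𝒞a x - 𝒞b x))) := by
  have h1t : 0 ≤ 1 - t := by linarith
  refine AbkmWeightBounds.stepKernelBounds_const_mul hd hMord hMR hLodd hL hθbar hlam hB hn hCα hk hρ0 hρ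
    (𝒞q := fun x => 𝒞b x + t * (𝒞a x - 𝒞b x)) (kernelSeg_even hea heb t) (fun κ => ?_) hp (fun κ => ?_)
    (fun q => ?_)
  · rw [re_fourierCoeff_kernelSeg]
    have : (fourierCoeff 𝒞b κ).re + t * ((fourierCoeff 𝒞a κ).re - (fourierCoeff 𝒞b κ).re) =
        (1 - t) * (fourierCoeff 𝒞b κ).re + t * (fourierCoeff 𝒞a κ).re := by ring
    rw [this]
    exact add_nonneg (mul_nonneg h1t (hb_nonneg κ)) (mul_nonneg ht0 (ha_nonneg κ))
  · rw [re_fourierCoeff_kernelSeg]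
    have e : p * ((fourierCoeff 𝒞b κ).re + t * ((fourierCoeff 𝒞a κ).re - (fourierCoeff 𝒞b κ).re)) =
        (1 - t) * (p * (fourierCoeff 𝒞b κ).re) + t * (p * (fourierCoeff 𝒞a κ).re) := by ring
    rw [e]
    calc (1 - t) * (p * (fourierCoeff 𝒞b κ).re) + t * (p * (fourierCoeff 𝒞a κ).re)
        ≤ (1 - t) * ((1 + ρ) * cExt N (fun j => fourierCoeff (𝒞 j) κ) (k + 1)) +
            t * ((1 + ρ) * cExt N (fun j => fourierCoeff (𝒞 j) κ) (k + 1)) :=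
          add_le_add (mul_le_mul_of_nonneg_left (hb_le κ) h1t) (mul_le_mul_of_nonneg_left (ha_le κ) ht0)
      _ = (1 + ρ) * cExt N (fun j => fourierCoeff (𝒞 j) κ) (k + 1) := by ring
  · rw [gradCov_kernelSeg]
    have e : gradCov 𝒞b q + t * (gradCov 𝒞a q - gradCov 𝒞b q) = (1 - t) * gradCov 𝒞b q + t * gradCov 𝒞a q := by
      ring
    rw [e]
    have hLk : (0 : ℝ) ≤ ((L ^ (d * k) : ℕ) : ℝ) := Nat.cast_nonneg _
    calc ((L ^ (d * k) : ℕ) : ℝ) * |(1 - t) * gradCov 𝒞b q + t * gradCov 𝒞a q|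
        ≤ ((L ^ (d * k) : ℕ) : ℝ) * ((1 - t) * |gradCov 𝒞b q| + t * |gradCov 𝒞a q|) := by
          refine mul_le_mul_of_nonneg_left ((abs_add_le _ _).trans (le_of_eq ?_)) hLk
          rw [abs_mul, abs_mul, abs_of_nonneg h1t, abs_of_nonneg ht0]
      _ = (1 - t) * (((L ^ (d * k) : ℕ) : ℝ) * |gradCov 𝒞b q|) + t * (((L ^ (d * k) : ℕ) : ℝ) * |gradCov 𝒞a q|) := by
          ring
      _ ≤ (1 - t) * C₂ + t * C₂ :=
          add_le_add (mul_le_mul_of_nonneg_left (hγb q) h1t) (mul_le_mul_of_nonneg_left (hγa q) ht0)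
      _ = C₂ := by ring

section Package

variable {L N Mord R n ñ : ℕ} {θbar lam μ δ₁ δ₀ A𝒫 : ℝ}
    {𝒞 : Matrix (Fin d) (Fin d) ℝ → ℕ → (Fin d → ZMod M) → ℝ} {Mc : ℕ → ℝ}
    {Cα : (Fin d → ℕ) → ℕ → ℝ} {c C : ℝ} {Cℓ : ℕ → ℝ}

/-- **`StepKernelBounds` for the dilated SEGMENT kernels
`p·(𝒞_{1+q,k+1} + t(𝒞_{1+q',k+1} − 𝒞_{1+q,k+1}))`, `t ∈ [0,1]`, of one `TorusFRD` package** (relative to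
the `q = 0` weights): for symmetric `q, q'` with `Σ|q_{ij}|, Σ|q'_{ij}| ≤ T₀`, `T₀ ≤ ½`, `K T₀ ≤ log(1+ρ)`,
`p ≥ 0`, `p(1+ρ) ≤ 1+ρ''`, `0 ≤ ρ'' < θ̄`; (w7′)-constant `A𝒫(ρ'')`, `γ`-constant `p·secondDiffConst`.
This is the hypothesis `hSp` of the dimension-free Lemma 8.4 (`tayNormLE_fluct_sub_fluct_of_sum_sq`).
[cite: AdamsBuchholzKoteckyMuller2019, Lemma 7.7 / Lemma 8.4] -/
theorem stepKernelBounds_const_mul_kernelSeg_of_torusFRD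
    (hd : 3 ≤ d) (hMord : 1 ≤ Mord) (hMR : Mord ≤ R) (hLodd : Odd L) (hL : 2 ^ (d + 3) + 16 * R ≤ L)
    (hθbar : 0 < θbar) (hlam : 0 < lam) (hn : 2 * Mord ≤ n) (hn2 : 2 ≤ n) (hnñ : n ≤ ñ)
    (hc : 0 < c) (hC1 : 0 ≤ Cℓ 1)
    (hallA : ∀ A : Matrix (Fin d) (Fin d) ℝ, IsElliptic (1 / 2 : ℝ) 2 A →
        (∀ k, 1 ≤ k → k ≤ N + 1 →
          ∑ x : Fin d → ZMod M, 𝒞 A k x = 0 ∧ ∀ x, 𝒞 A k (-x) = 𝒞 A k x) ∧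
        (∀ k, 1 ≤ k → k ≤ N + 1 → ∀ φ : (Fin d → ZMod M) → ℝ, ∑ x, φ x = 0 →
          0 ≤ ∑ x, ∑ y, φ x * 𝒞 A k (x - y) * φ y) ∧
        (∀ φ : (Fin d → ZMod M) → ℝ, ∑ x, φ x = 0 →
          ellOp A (conv (fun x => ∑ k ∈ Finset.Icc 1 (N + 1), 𝒞 A k x) φ) = φ) ∧
        (∀ k, 1 ≤ k → k ≤ N → Mc k ≤ 0 ∧
          ∀ x : Fin d → ZMod M, ((L : ℝ) ^ k) / 2 ≤ (supNorm x : ℝ) →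
            𝒞 A k x = Mc k) ∧
        (∀ k, 1 ≤ k → k ≤ N + 1 → ∀ B : Matrix (Fin d) (Fin d) ℝ, IsUnitSymm B →
          (∃ ε : ℝ, 0 < ε ∧ ∀ x : Fin d → ZMod M,
            ContDiffOn ℝ ⊤ (fun s : ℝ => 𝒞 (A + s • B) k x) (Set.Ioo (-ε) ε)) ∧
          ∀ α : Fin d → ℕ, ∑ i, α i ≤ n → ∀ ℓ : ℕ, ∀ x : Fin d → ZMod M,
            abs (iteratedDeriv ℓ (fun s : ℝ => iterDiff α (𝒞 (A + s • B) k) x) 0)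
              ≤ Cα α ℓ / (L : ℝ) ^ ((k - 1) * (d - 2 + ∑ i, α i))) ∧
        (∀ k, 1 ≤ k → k ≤ N + 1 → ∀ j : ℕ, ∀ κ : Fin d → ZMod M, κ ≠ 0 → InShell L j κ →
          (j < k →
            c / (L : ℝ) ^ (2 * (d + ñ) + 1) * (L : ℝ) ^ (2 * j)
                / (L : ℝ) ^ ((k - j) * (d - 1 + n)) ≤ (fourierCoeff (𝒞 A k) κ).re ∧
            ‖fourierCoeff (𝒞 A k) κ‖
              ≤ C * (L : ℝ) ^ (2 * (d + ñ) + 1) * (L : ℝ) ^ (2 * j)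
                  / (L : ℝ) ^ ((k - j) * (d - 1 + n))) ∧
          (k ≤ j →
            c / (L : ℝ) ^ (2 * (d + ñ) + 1) * (L : ℝ) ^ (2 * k)
                ≤ (fourierCoeff (𝒞 A k) κ).re ∧
            ‖fourierCoeff (𝒞 A k) κ‖ ≤ C * (L : ℝ) ^ (2 * k)) ∧
          ∀ B : Matrix (Fin d) (Fin d) ℝ, IsUnitSymm B → ∀ ℓ : ℕ, 1 ≤ ℓ →
            (j < k →
              ‖iteratedDeriv ℓ (fun s : ℝ => fourierCoeff (𝒞 (A + s • B) k) κ) 0‖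
                ≤ Cℓ ℓ * (L : ℝ) ^ (2 * (d + ñ) + 1) * (L : ℝ) ^ (2 * j)
                    / (L : ℝ) ^ ((k - j) * (d - 1 + ñ))) ∧
            (k ≤ j →
              ‖iteratedDeriv ℓ (fun s : ℝ => fourierCoeff (𝒞 (A + s • B) k) κ) 0‖
                ≤ Cℓ ℓ * (L : ℝ) ^ (2 * k))))
    (hB : AbkmWeightBounds L N Mord R n θbar lam μ δ₁ δ₀ A𝒫 (fun j => 𝒞 1 j)
      (abkmWeightData L N Mord R θbar (schedDelta δ₀ δ₁ N) fun j => 𝒞 1 j))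
    {k : ℕ} (hk : k + 1 ≤ N + 1) {ρ : ℝ} (hρ0 : 0 ≤ ρ)
    {T₀ : ℝ} (hT₀ : T₀ ≤ 1 / 2) (hKT₀ : shellRatioConst c (Cℓ 1) (L : ℝ) d ñ * T₀ ≤ Real.log (1 + ρ))
    {q q' : Matrix (Fin d) (Fin d) ℝ} (hq : q.IsSymm) (hq' : q'.IsSymm)
    (hqT : ∑ i, ∑ j, |q i j| ≤ T₀) (hq'T : ∑ i, ∑ j, |q' i j| ≤ T₀)
    {p ρ'' : ℝ} (hp : 0 ≤ p) (hρ''0 : 0 ≤ ρ'') (hρ'' : ρ'' < θbar) (hpρ : p * (1 + ρ) ≤ 1 + ρ'')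
    {t : ℝ} (ht0 : 0 ≤ t) (ht1 : t ≤ 1) :
    StepKernelBounds (abkmWeightData L N Mord R θbar (schedDelta δ₀ δ₁ N) fun j => 𝒞 1 j) L k
      (weightIntConstRho θbar ρ'' (traceConst d Mord R lam (derivSum d n fun θ' _ => Cα θ' 0)))
      (p * secondDiffConst fun θ' => Cα θ' 0)
      (fun x => p * (𝒞 ((1 : Matrix (Fin d) (Fin d) ℝ) + q) (k + 1) x +
        t * (𝒞 ((1 : Matrix (Fin d) (Fin d) ℝ) + q') (k + 1) x - 𝒞 ((1 : Matrix (Fin d) (Fin d) ℝ) + q) (k + 1) x))) := by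
  have h8 : 8 ≤ 2 ^ (d + 3) := by
    calc 8 = 2 ^ 3 := by norm_num
      _ ≤ 2 ^ (d + 3) := Nat.pow_le_pow_right (by norm_num) (by omega)
  have hL2 : 2 ≤ L := by omega
  have hL1 : 1 ≤ L := by omega
  have hd2 : 2 ≤ d := by omega
  have hL0 : (0 : ℝ) ≤ (L : ℝ) := Nat.cast_nonneg _
  have hK0 : 0 ≤ shellRatioConst c (Cℓ 1) (L : ℝ) d ñ := shellRatioConst_nonneg hc hC1 hL0 d ñ
  -- regularity of every elliptic family with the same constants (clause (iv), `ℓ = 0`)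
  have hreg : ∀ A : Matrix (Fin d) (Fin d) ℝ, IsElliptic (1 / 2 : ℝ) 2 A →
      ∀ j, 1 ≤ j → j ≤ N + 1 → ∀ θ' : Fin d → ℕ, ∑ i, θ' i ≤ n → ∀ x,
        |iterDiff θ' (𝒞 A j) x| ≤ Cα θ' 0 / (L : ℝ) ^ ((j - 1) * (d - 2 + ∑ i, θ' i)) := by
    intro A hA j hj1 hjN θ' hθ' x
    obtain ⟨-, hb⟩ := (hallA A hA).2.2.2.2.1 j hj1 hjN 0 isUnitSymm_zero
    have := hb θ' hθ' 0 x
    rw [iteratedDeriv_zero] at this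
    simpa only [smul_zero, add_zero] using this
  -- the per-kernel facts for `A = 1 + m`, `m` symmetric in the ball
  have hfacts : ∀ {m : Matrix (Fin d) (Fin d) ℝ}, m.IsSymm → ∑ i, ∑ j, |m i j| ≤ T₀ →
      (∀ x, 𝒞 ((1 : Matrix (Fin d) (Fin d) ℝ) + m) (k + 1) (-x) = 𝒞 ((1 : Matrix (Fin d) (Fin d) ℝ) + m) (k + 1) x) ∧
      (∀ κ, 0 ≤ (fourierCoeff (𝒞 ((1 : Matrix (Fin d) (Fin d) ℝ) + m) (k + 1)) κ).re) ∧
      (∀ κ, p * (fourierCoeff (𝒞 ((1 : Matrix (Fin d) (Fin d) ℝ) + m) (k + 1)) κ).re ≤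
        (1 + ρ'') * cExt N (fun j => fourierCoeff (𝒞 1 j) κ) (k + 1)) ∧
      (∀ qi : quadIndex d, ((L ^ (d * k) : ℕ) : ℝ) *
        |gradCov (𝒞 ((1 : Matrix (Fin d) (Fin d) ℝ) + m) (k + 1)) qi| ≤ secondDiffConst fun θ' => Cα θ' 0) := by
    intro m hm hmT
    obtain ⟨B, hBu, hmB⟩ := exists_isUnitSymm_eq_smul hm
    set T := ∑ i, ∑ j, |m i j| with hTdef
    have hT0 : 0 ≤ T := sum_nonneg fun _ _ => sum_nonneg fun _ _ => abs_nonneg _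
    have hT : T ≤ 1 / 2 := hmT.trans hT₀
    have hKT : shellRatioConst c (Cℓ 1) (L : ℝ) d ñ * T ≤ Real.log (1 + ρ) :=
      (mul_le_mul_of_nonneg_left hmT hK0).trans hKT₀
    set A' : Matrix (Fin d) (Fin d) ℝ := 1 + m with hA'
    have hA'TB : A' = 1 + T • B := by rw [hA', hmB]
    have hellA' : IsElliptic (1 / 2 : ℝ) 2 A' := by rw [hA'TB]; exact isElliptic_one_add_smul hBu hT0 hT
    have hqA := hallA A' hellA'
    refine ⟨(hqA.1 (k + 1) (by omega) hk).2, fun κ => ?_, fun κ => ?_, fun qi => ?_⟩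
    · exact re_fourierCoeff_nonneg_of_torusFRD hqA.1 hqA.2.2.2.2.2 hc hL2 (by omega) hk κ
    · have hnn : 0 ≤ cExt N (fun j => fourierCoeff (𝒞 1 j) κ) (k + 1) := hB.multipliers_nonneg (k + 1) κ
      have h1 : (fourierCoeff (𝒞 A' (k + 1)) κ).re ≤ (1 + ρ) * cExt N (fun j => fourierCoeff (𝒞 1 j) κ) (k + 1) := by
        rw [cExt_of_mem (f := fun j => fourierCoeff (𝒞 1 j) κ) (by omega) hk, hA'TB]
        exact re_fourierCoeff_one_add_smul_le (fun A hA => (hallA A hA).1) (fun A hA => (hallA A hA).2.2.2.2.1)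
          (fun A hA => (hallA A hA).2.2.2.2.2) hc hC1 hL2 hnñ hBu hT0 hT (by omega) hk hρ0 hKT κ
      calc p * (fourierCoeff (𝒞 A' (k + 1)) κ).re ≤ p * ((1 + ρ) * cExt N (fun j => fourierCoeff (𝒞 1 j) κ) (k + 1)) :=
            mul_le_mul_of_nonneg_left h1 hp
        _ = p * (1 + ρ) * cExt N (fun j => fourierCoeff (𝒞 1 j) κ) (k + 1) := by ring
        _ ≤ (1 + ρ'') * cExt N (fun j => fourierCoeff (𝒞 1 j) κ) (k + 1) :=
            mul_le_mul_of_nonneg_right hpρ hnn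
    · exact abs_gradCov_abkm_le (𝒞 := fun j => 𝒞 A' j) hd2 hn2 hL1 (hreg A' hellA') hk qi
  obtain ⟨hev_b, hnn_b, hle_b, hγ_b⟩ := hfacts hq hqT
  obtain ⟨hev_a, hnn_a, hle_a, hγ_a⟩ := hfacts hq' hq'T
  exact AbkmWeightBounds.stepKernelBounds_const_mul_kernelSeg hd2 hMord hMR hLodd hL hθbar hlam hB hn
    (hreg 1 isElliptic_one) hk hρ''0 hρ'' hev_a hev_b hnn_a hnn_b hp hle_a hle_b hγ_a hγ_b ht0 ht1

end Package

end Literature.MathematicalPhysics.StatisticalMechanics.GradientRG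

end
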